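import Mathlib
import HarnessLib
import Summits.NavierStokesRegularity.NavierStokesRegularity.Theorems.PoloidalWindowDoorPoloidalWindowRigidityStrainRate
import Summits.NavierStokesRegularity.NavierStokesRegularity.Theorems.PoloidalWindowDoorPoloidalWindowRigidityPoloidalExtremal

/-!
# Route `PoloidalWindowDoor`, crux `PoloidalWindowRigidity` (K2, stmt-NavierStokesRegularity-19708) —
# the exact weighted enstrophy balance and the ENSTROPHY HOT-SPOT normal form

Cell ns-regularity-ideate, seat nsreg-p7 gen 5 (third worker under the K2 lead ns-poloidal-K2-p1; file landed
`--supports stmt-NavierStokesRegularity-19708`).  Two tools for mechanism M10 (CENSUS-K2G §16, enstrophy Gronwall from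
`t = −∞`) AT the critical rate:

* `weightedEnstrophy_identity` — the exact pointwise balance of the weighted enstrophy density `Q = g(t)|ω|²` of a
  profile of the route's Type-I class: `∂ₜQ + DQ(v) − ΔQ = g′|ω|² + g (2⟪ω, Dv ω⟫ − 2|∇ω|²_F)` (the companion of
  p473649's `weightedEnstrophy_subsolution`, which discards the dissipation `|∇ω|²_F = frobeniusNormSq (D curl v)`);
* `critEnstrophy_nsRescale_translate` — the scale-invariant enstrophy `(−t)²|curl v(t,x)|²` is invariant under the
  symmetries of the class (spatial translations, parabolic rescalings);
* `exists_enstrophy_hotSpot` — **ENSTROPHY HOT-SPOT NORMAL FORM.**  Let `P` be any property of profiles preserved by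
  translations, parabolic rescalings and the KNSS limits of the class (pointwise convergence of fields and gradients,
  `exists_tendsto_of_isTypeIAncientMild_seq`).  If some `v ∈ 𝔓(C)` with `P v` has `curl v ≢ 0`, then there are
  `W ∈ 𝔓(C)` with `P W` and `M > 0` such that `(−t)²|curl W(t,x)|² ≤ M` on the slab with EQUALITY at the hot spot
  `(−1, 0)`.  (`M = sup (−t)²|curl v|²`, finite by the class vorticity rate `|curl v(t)| ≤ C₂/(−t)` of p450704;
  renormalise near-maximal points to `(−1,0)` and extract a limit.)  The vorticity analogue of the lead's velocity
  hot spot (p469616 `exists_poloidal_extremal`, p472559 `hotSpot_firstOrder`); consumed by the companion file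
  `…CriticalProduction` with `P` = «enstrophy production at most critical».

WHAT THIS IS NOT: not a proof of K2 and nothing about Clay (A) — a normal form (compactness + symmetry) and an identity
(bears_on LADDER-NS N0, route PoloidalWindowDoor).
-/

noncomputable section

-- the summit and its single sub-problem share the name (CONVENTIONS §1), as in every Theorems file
set_option linter.dupNamespace false

namespace Summit.NavierStokesRegularity.NavierStokesRegularity.Theorems.PoloidalWindowDoorPoloidalWindowRigidityEnstrophyHotSpot

open MeasureTheory Set Function Filter Topology TopologicalSpace Metric InnerProductSpace
open scoped RealInnerProductSpace InnerProductSpace Laplacian ContDiff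
open Literature.Analysis Literature.Analysis.FluidPDE
open Summit.NavierStokesRegularity.NavierStokesRegularity.Theorems
open Summit.NavierStokesRegularity.NavierStokesRegularity.Theorems.LocalSineTubeDoorProfileAlignedWindowRigidityAncient
open Summit.NavierStokesRegularity.NavierStokesRegularity.Theorems.PoloidalWindowDoorPoloidalWindowRigidityWindow
open Summit.NavierStokesRegularity.NavierStokesRegularity.Theorems.PoloidalWindowDoorPoloidalWindowRigidityClassRate
open Summit.NavierStokesRegularity.NavierStokesRegularity.Theorems.LocalSineTubeDoorEnstrophyProductionProfileRigidity
open Summit.NavierStokesRegularity.NavierStokesRegularity.Theorems.PoloidalWindowDoorPoloidalWindowRigidityPoloidalExtremal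

variable {C : ℝ} {v : ℝ → EuclideanSpace ℝ (Fin 3) → EuclideanSpace ℝ (Fin 3)}

/-! ### The exact weighted enstrophy balance -/

/-- **The exact balance of the weighted enstrophy density `Q = g(t)|ω|²`** of a profile of the class, at every point
of the open slab: `Q` has a classical time derivative and
`∂ₜQ + DQ(v) − ΔQ = g′(t)|ω|² + g(t) (2⟪ω, Dv ω⟫ − 2 |∇ω|²_F)`, `|∇ω|²_F = frobeniusNormSq (D(curl v(t)))(x)`
(tree `enstrophyDensity_balance`, p459001, with the weight differentiated in). -/
theorem weightedEnstrophy_identity (hrate : HasTypeITimeDecay C v)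
    (hcont : ContinuousOn (uncurry v) (Iio (0 : ℝ) ×ˢ univ))
    (hmild : ∀ s t : ℝ, s < t → t < 0 → ∀ x,
      v t x = UnboundedOperators.heatExtension (v s) (t - s) x - oseenDuhamel 1 s v v t x)
    (hdiv : ∀ t < 0, VectorCalculus.IsDivFree (v t))
    {g g' : ℝ → ℝ} (hg : ∀ t < 0, HasDerivAt g (g' t) t)
    {t : ℝ} (ht : t < 0) (x : EuclideanSpace ℝ (Fin 3)) :
    HasDerivAt (fun τ => g τ * ⟪curl (v τ) x, curl (v τ) x⟫_ℝ)
        (deriv (fun τ => g τ * ⟪curl (v τ) x, curl (v τ) x⟫_ℝ) t) t ∧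
      deriv (fun τ => g τ * ⟪curl (v τ) x, curl (v τ) x⟫_ℝ) t +
          fderiv ℝ (fun y => g t * ⟪curl (v t) y, curl (v t) y⟫_ℝ) x (v t x) -
          (Δ (fun y => g t * ⟪curl (v t) y, curl (v t) y⟫_ℝ)) x =
        g' t * ⟪curl (v t) x, curl (v t) x⟫_ℝ +
          g t * (2 * ⟪curl (v t) x, fderiv ℝ (v t) x (curl (v t) x)⟫_ℝ -
            2 * frobeniusNormSq (fderiv ℝ (curl (v t)) x)) := by
  have hA : IsTypeIAncientMild C v := isTypeIAncientMild_of_class hrate hcont hmild hdiv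
  have ht₀ : t - 1 < 0 := by linarith
  have htI : t ∈ Ioo (t - 1) 0 := ⟨by linarith, ht⟩
  obtain ⟨p, hcl⟩ := hA.exists_isClassicalNSSolutionOn_Ioo ht₀
  have hbal := enstrophyDensity_balance isOpen_Ioo hcl htI x
  -- the enstrophy density `q` and its time derivative within the open window = the two-sided derivative
  set q : ℝ → EuclideanSpace ℝ (Fin 3) → ℝ := fun τ y => ⟪curl (v τ) y, curl (v τ) y⟫_ℝ with hqdef
  have hdω : HasDerivWithinAt (fun τ => vorticity v τ x) (timeDerivWithin (Ioo (t - 1) 0) (vorticity v) t x)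
      (Ioo (t - 1) 0) t := by
    rw [timeDerivWithin_apply]
    exact ((hcl.smooth_velocity.isSmoothSpaceTimeOn_vorticity isOpen_Ioo.uniqueDiffOn).differentiableWithinAt_time
      htI x).hasDerivWithinAt
  have hq : HasDerivAt (fun τ => q τ x)
      (⟪vorticity v t x, timeDerivWithin (Ioo (t - 1) 0) (vorticity v) t x⟫_ℝ +
        ⟪timeDerivWithin (Ioo (t - 1) 0) (vorticity v) t x, vorticity v t x⟫_ℝ) t := by
    have h := (hdω.inner ℝ hdω).hasDerivAt (isOpen_Ioo.mem_nhds htI)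
    simpa only [vorticity_apply] using h
  have hqd : HasDerivAt (fun τ => q τ x) (deriv (fun τ => q τ x) t) t := hq.differentiableAt.hasDerivAt
  have hderiv : deriv (fun τ => q τ x) t =
      timeDerivWithin (Ioo (t - 1) 0) (fun τ y => ⟪curl (v τ) y, curl (v τ) y⟫_ℝ) t x := by
    rw [timeDerivWithin_apply, derivWithin_of_isOpen isOpen_Ioo htI]
  -- the weighted density
  have hQ : HasDerivAt (fun τ => g τ * q τ x) (g' t * q t x + g t * deriv (fun τ => q τ x) t) t :=
    (hg t ht).mul hqd
  refine ⟨hQ.differentiableAt.hasDerivAt, ?_⟩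
  rw [hQ.deriv]
  -- spatial derivatives of `y ↦ g t * q t y`
  have hΩ2 : ContDiff ℝ 2 (curl (v t)) :=
    contDiff_curl (n := 2) (analyticOnNhd_slice hcont (bdd_of_hasTypeITimeDecay hrate) hmild ht).contDiff
  have hq2 : ContDiff ℝ 2 (q t) := hΩ2.inner ℝ hΩ2
  have hsm : (fun y => g t * q t y) = g t • q t := by funext y; simp [hqdef]
  have hfd : fderiv ℝ (fun y => g t * q t y) x (v t x) = g t * fderiv ℝ (q t) x (v t x) := by
    rw [hsm, fderiv_const_smul (hq2.differentiable (by norm_num) x)]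
    simp
  have hlap : (Δ (fun y => g t * q t y)) x = g t * (Δ (q t)) x := by
    rw [hsm, laplacian_smul (g t) (hq2.contDiffAt (x := x))]
    simp
  rw [hfd, hlap, hderiv]
  -- the balance with unit viscosity
  have hbal' : timeDerivWithin (Ioo (t - 1) 0) (fun τ y => ⟪curl (v τ) y, curl (v τ) y⟫_ℝ) t x =
      2 * ⟪curl (v t) x, fderiv ℝ (v t) x (curl (v t) x)⟫_ℝ - 2 * 1 * frobeniusNormSq (fderiv ℝ (curl (v t)) x) -
        fderiv ℝ (fun y => ⟪curl (v t) y, curl (v t) y⟫_ℝ) x (v t x) +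
        1 * (Δ (fun y => ⟪curl (v t) y, curl (v t) y⟫_ℝ)) x := by
    linarith [hbal]
  simp only [hqdef] at hbal' ⊢
  rw [hbal']
  ring

/-! ### The scale-invariant enstrophy under the symmetries of the class -/

/-- Enstrophy density of a translate–rescale: for `c ≠ 0`-free bookkeeping,
`|curl (nsRescale c (u(·, x₀ + ·)))(s, y)|² = c⁴ |curl u(c²s, x₀ + c y)|²`. -/
theorem enstrophy_nsRescale_translate (c : ℝ) (u : ℝ → EuclideanSpace ℝ (Fin 3) → EuclideanSpace ℝ (Fin 3))
    (x₀ : EuclideanSpace ℝ (Fin 3)) (s : ℝ) (y : EuclideanSpace ℝ (Fin 3)) :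
    ⟪curl (nsRescale c (fun t x => u t (x₀ + x)) s) y, curl (nsRescale c (fun t x => u t (x₀ + x)) s) y⟫_ℝ =
      c ^ 4 * ⟪curl (u (c ^ 2 * s)) (x₀ + c • y), curl (u (c ^ 2 * s)) (x₀ + c • y)⟫_ℝ := by
  rw [curl_nsRescale_slice, curl_translate, real_inner_smul_left, real_inner_smul_right]
  ring

/-- **The scale-invariant enstrophy `(−t)²|curl v(t,x)|²` is invariant under the symmetries of the class**: for
`c > 0`, `(−s)² |curl (nsRescale c (v(·, x₀ + ·)))(s, y)|² = (−(c²s))² |curl v(c²s, x₀ + c y)|²`. -/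
theorem critEnstrophy_nsRescale_translate (c : ℝ) (u : ℝ → EuclideanSpace ℝ (Fin 3) → EuclideanSpace ℝ (Fin 3))
    (x₀ : EuclideanSpace ℝ (Fin 3)) (s : ℝ) (y : EuclideanSpace ℝ (Fin 3)) :
    (-s) ^ 2 * ⟪curl (nsRescale c (fun t x => u t (x₀ + x)) s) y,
        curl (nsRescale c (fun t x => u t (x₀ + x)) s) y⟫_ℝ =
      (-(c ^ 2 * s)) ^ 2 * ⟪curl (u (c ^ 2 * s)) (x₀ + c • y), curl (u (c ^ 2 * s)) (x₀ + c • y)⟫_ℝ := by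
  rw [enstrophy_nsRescale_translate]
  ring

/-! ### The enstrophy hot-spot normal form -/

/-- **ENSTROPHY HOT-SPOT NORMAL FORM.**  Let `P` be a property of profiles that is preserved by spatial translations,
by the parabolic rescalings `nsRescale c`, `c > 0`, and by the KNSS limits of the class `𝔓(C)` (pointwise
convergence of fields and gradients along a sequence of elements of `𝔓(C)` satisfying `P`).  If some `v ∈ 𝔓(C)` with
`P v` is NOT irrotational, then there are `W ∈ 𝔓(C)` with `P W` and `M > 0` such that the scale-invariant enstrophy
`(−t)²|curl W(t,x)|²` is `≤ M` on the whole slab and EQUALS `M` at the hot spot `(−1, 0)`.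
(`M = sup_{t<0,x} (−t)²|curl v(t,x)|² ≤ C₂²` by the class vorticity rate; near-maximal points `(t_k, x_k)` are
moved to `(−1, 0)` by `v ↦ √(−t_k) v(−t_k ·, x_k + √(−t_k) ·)`, which preserves `𝔓(C)`, `P` and the bound `M`;
a KNSS limit (`exists_tendsto_of_isTypeIAncientMild_seq`) attains `M`.) -/
theorem exists_enstrophy_hotSpot {P : (ℝ → EuclideanSpace ℝ (Fin 3) → EuclideanSpace ℝ (Fin 3)) → Prop}
    (hPtr : ∀ (u : ℝ → EuclideanSpace ℝ (Fin 3) → EuclideanSpace ℝ (Fin 3)) (x₀ : EuclideanSpace ℝ (Fin 3)),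
      P u → P (fun t x => u t (x₀ + x)))
    (hPsc : ∀ (u : ℝ → EuclideanSpace ℝ (Fin 3) → EuclideanSpace ℝ (Fin 3)) (c : ℝ), 0 < c →
      P u → P (nsRescale c u))
    (hPlim : ∀ (w : ℕ → ℝ → EuclideanSpace ℝ (Fin 3) → EuclideanSpace ℝ (Fin 3))
      (W : ℝ → EuclideanSpace ℝ (Fin 3) → EuclideanSpace ℝ (Fin 3)),
      (∀ k, IsTypeIAncientMild C (w k)) → (∀ k, P (w k)) → IsTypeIAncientMild C W →
      (∀ t < 0, ∀ x, Tendsto (fun j => w j t x) atTop (𝓝 (W t x))) →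
      (∀ t < 0, ∀ x, Tendsto (fun j => fderiv ℝ (w j t) x) atTop (𝓝 (fderiv ℝ (W t) x))) → P W)
    (hv : IsTypeIAncientMild C v) (hPv : P v) {s₀ : ℝ} (hs₀ : s₀ < 0) {y₀ : EuclideanSpace ℝ (Fin 3)}
    (hne : curl (v s₀) y₀ ≠ 0) :
    ∃ (W : ℝ → EuclideanSpace ℝ (Fin 3) → EuclideanSpace ℝ (Fin 3)) (M : ℝ),
      IsTypeIAncientMild C W ∧ P W ∧ 0 < M ∧
      (∀ t < 0, ∀ x, (-t) ^ 2 * ⟪curl (W t) x, curl (W t) x⟫_ℝ ≤ M) ∧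
      ⟪curl (W (-1)) 0, curl (W (-1)) 0⟫_ℝ = M := by
  -- the class data of `v` in the route's four-hypothesis form
  have hrate : HasTypeITimeDecay C v := hv.hasTypeITimeDecay
  have hcont : ContinuousOn (uncurry v) (Iio (0 : ℝ) ×ˢ univ) := hv.continuousOn_uncurry
  have hmild : ∀ s t : ℝ, s < t → t < 0 → ∀ x,
      v t x = UnboundedOperators.heatExtension (v s) (t - s) x - oseenDuhamel 1 s v v t x :=
    fun s t hst ht x => hv.mild_eq_heatExtension hst ht x
  -- the scale-invariant enstrophy and its supremum
  set Q : ℝ → EuclideanSpace ℝ (Fin 3) → ℝ := fun t x => (-t) ^ 2 * ⟪curl (v t) x, curl (v t) x⟫_ℝ with hQdef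
  obtain ⟨C₂, hC₂⟩ := exists_curl_rate_of_class hrate hcont hmild
  have hQle : ∀ t < 0, ∀ x, Q t x ≤ C₂ ^ 2 := by
    intro t ht x
    have h1 : ‖curl (v t) x‖ ≤ C₂ / (-t) := hC₂ t ht x
    have h2 : (-t) * ‖curl (v t) x‖ ≤ C₂ := by
      rw [le_div_iff₀ (neg_pos.2 ht)] at h1; linarith
    have h3 : 0 ≤ (-t) * ‖curl (v t) x‖ := mul_nonneg (neg_pos.2 ht).le (norm_nonneg _)
    simp only [hQdef, real_inner_self_eq_norm_sq]
    nlinarith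
  set S : Set ℝ := {m | ∃ t < 0, ∃ x, m = Q t x} with hSdef
  have hSbdd : BddAbove S := ⟨C₂ ^ 2, by rintro m ⟨t, ht, x, rfl⟩; exact hQle t ht x⟩
  have hS0 : Q s₀ y₀ ∈ S := ⟨s₀, hs₀, y₀, rfl⟩
  set M : ℝ := sSup S with hMdef
  have hQM : ∀ t < 0, ∀ x, Q t x ≤ M := fun t ht x => le_csSup hSbdd ⟨t, ht, x, rfl⟩
  have hQ0pos : 0 < Q s₀ y₀ := by
    simp only [hQdef, real_inner_self_eq_norm_sq]
    exact mul_pos (pow_pos (neg_pos.2 hs₀) 2) (pow_pos (norm_pos_iff.2 hne) 2)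
  have hMpos : 0 < M := hQ0pos.trans_le (hQM s₀ hs₀ y₀)
  -- near-maximal points
  have hpts : ∀ k : ℕ, ∃ t < 0, ∃ x : EuclideanSpace ℝ (Fin 3), M - 1 / ((k : ℝ) + 1) < Q t x := by
    intro k
    have hlt : M - 1 / ((k : ℝ) + 1) < sSup S := by
      have : (0 : ℝ) < 1 / ((k : ℝ) + 1) := by positivity
      rw [hMdef]; linarith
    obtain ⟨m, ⟨t, ht, x, rfl⟩, hm⟩ := exists_lt_of_lt_csSup ⟨_, hS0⟩ hlt
    exact ⟨t, ht, x, hm⟩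
  choose tk htk xk hxk using hpts
  -- renormalisation to the hot spot `(−1, 0)`
  set vk : ℕ → ℝ → EuclideanSpace ℝ (Fin 3) → EuclideanSpace ℝ (Fin 3) := fun k =>
    nsRescale (Real.sqrt (-tk k)) (fun t x => v t (xk k + x)) with hvk_def
  have hck : ∀ k, 0 < Real.sqrt (-tk k) := fun k => Real.sqrt_pos.2 (neg_pos.2 (htk k))
  have hck2 : ∀ k, Real.sqrt (-tk k) ^ 2 = -tk k := fun k => Real.sq_sqrt (neg_pos.2 (htk k)).le
  have hvk : ∀ k, IsTypeIAncientMild C (vk k) := fun k =>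
    isTypeIAncientMild_nsRescale (isTypeIAncientMild_translate hv (xk k)) (hck k)
  have hvkP : ∀ k, P (vk k) := fun k => hPsc _ _ (hck k) (hPtr _ (xk k) hPv)
  -- the scale-invariant enstrophy of `vk k` is that of `v` at the moved point
  have hQvk : ∀ k, ∀ t < 0, ∀ x, (-t) ^ 2 * ⟪curl (vk k t) x, curl (vk k t) x⟫_ℝ =
      Q (Real.sqrt (-tk k) ^ 2 * t) (xk k + Real.sqrt (-tk k) • x) := by
    intro k t ht x
    simp only [hvk_def, hQdef]
    exact critEnstrophy_nsRescale_translate _ _ _ _ _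
  have hQvk_le : ∀ k, ∀ t < 0, ∀ x, (-t) ^ 2 * ⟪curl (vk k t) x, curl (vk k t) x⟫_ℝ ≤ M := by
    intro k t ht x
    rw [hQvk k t ht x]
    refine hQM _ ?_ _
    rw [hck2]
    exact mul_neg_of_pos_of_neg (neg_pos.2 (htk k)) ht
  have hQvk_one : ∀ k, ⟪curl (vk k (-1)) 0, curl (vk k (-1)) 0⟫_ℝ = Q (tk k) (xk k) := by
    intro k
    have h := hQvk k (-1) (by norm_num) 0
    rw [hck2, smul_zero, add_zero] at h
    have e : -tk k * (-1 : ℝ) = tk k := by ring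
    rw [e] at h
    simpa using h
  -- extraction of a limit
  obtain ⟨φ, hφ, W, hW, hpt, hgrad, -, -⟩ := exists_tendsto_of_isTypeIAncientMild_seq C hvk
  have hPW : P W := hPlim (fun j => vk (φ j)) W (fun j => hvk (φ j)) (fun j => hvkP (φ j)) hW hpt hgrad
  -- convergence of the enstrophy densities
  have hconv : ∀ t < 0, ∀ x, Tendsto (fun j => ⟪curl (vk (φ j) t) x, curl (vk (φ j) t) x⟫_ℝ) atTop
      (𝓝 ⟪curl (W t) x, curl (W t) x⟫_ℝ) := by
    intro t ht x
    have hc := tendsto_curl_of_tendsto_fderiv (hgrad t ht x)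
    exact hc.inner hc
  refine ⟨W, M, hW, hPW, hMpos, fun t ht x => ?_, ?_⟩
  · have h := (hconv t ht x).const_mul ((-t) ^ 2)
    exact le_of_tendsto' h fun j => hQvk_le (φ j) t ht x
  · -- at the hot spot the values `Q (t_{φ j}) (x_{φ j}) ∈ (M − 1/(φ j + 1), M]` converge to `M`
    have h1 := hconv (-1) (by norm_num) 0
    have hεj : Tendsto (fun j : ℕ => M - 1 / ((φ j : ℝ) + 1)) atTop (𝓝 M) := by
      have h0 : Tendsto (fun j : ℕ => 1 / ((φ j : ℝ) + 1)) atTop (𝓝 0) := by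
        have ha : Tendsto (fun j : ℕ => (φ j : ℝ) + 1) atTop atTop := by
          refine tendsto_atTop_add_const_right _ 1 ?_
          exact tendsto_natCast_atTop_atTop.comp hφ.tendsto_atTop
        refine (tendsto_inv_atTop_zero.comp ha).congr fun j => ?_
        simp [one_div, Function.comp]
      simpa using (tendsto_const_nhds (x := M)).sub h0
    have h2 : Tendsto (fun j => ⟪curl (vk (φ j) (-1)) 0, curl (vk (φ j) (-1)) 0⟫_ℝ) atTop (𝓝 M) := by
      refine tendsto_of_tendsto_of_tendsto_of_le_of_le hεj tendsto_const_nhds (fun j => ?_) (fun j => ?_)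
      · rw [hQvk_one]; exact (hxk (φ j)).le
      · rw [hQvk_one]; exact hQM _ (htk (φ j)) _
    exact tendsto_nhds_unique h1 h2

/-- **ENSTROPHY HOT-SPOT NORMAL FORM, with the supremum identified** (appended by nsreg-p7 g5 for the near-peak
sharpening `…NearPeakCriticalProduction`): as `exists_enstrophy_hotSpot`, and IN ADDITION the attained value `M`
dominates the scale-invariant enstrophy of the ORIGINAL profile, `(−t)²|curl v(t,x)|² ≤ M` for all `t < 0`, `x`
(it is its supremum).  Statement otherwise verbatim.

**ENSTROPHY HOT-SPOT NORMAL FORM.**  Let `P` be a property of profiles that is preserved by spatial translations,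
by the parabolic rescalings `nsRescale c`, `c > 0`, and by the KNSS limits of the class `𝔓(C)` (pointwise
convergence of fields and gradients along a sequence of elements of `𝔓(C)` satisfying `P`).  If some `v ∈ 𝔓(C)` with
`P v` is NOT irrotational, then there are `W ∈ 𝔓(C)` with `P W` and `M > 0` such that the scale-invariant enstrophy
`(−t)²|curl W(t,x)|²` is `≤ M` on the whole slab and EQUALS `M` at the hot spot `(−1, 0)`.
(`M = sup_{t<0,x} (−t)²|curl v(t,x)|² ≤ C₂²` by the class vorticity rate; near-maximal points `(t_k, x_k)` are
moved to `(−1, 0)` by `v ↦ √(−t_k) v(−t_k ·, x_k + √(−t_k) ·)`, which preserves `𝔓(C)`, `P` and the bound `M`;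
a KNSS limit (`exists_tendsto_of_isTypeIAncientMild_seq`) attains `M`.) -/
theorem exists_enstrophy_hotSpot_sup {P : (ℝ → EuclideanSpace ℝ (Fin 3) → EuclideanSpace ℝ (Fin 3)) → Prop}
    (hPtr : ∀ (u : ℝ → EuclideanSpace ℝ (Fin 3) → EuclideanSpace ℝ (Fin 3)) (x₀ : EuclideanSpace ℝ (Fin 3)),
      P u → P (fun t x => u t (x₀ + x)))
    (hPsc : ∀ (u : ℝ → EuclideanSpace ℝ (Fin 3) → EuclideanSpace ℝ (Fin 3)) (c : ℝ), 0 < c →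
      P u → P (nsRescale c u))
    (hPlim : ∀ (w : ℕ → ℝ → EuclideanSpace ℝ (Fin 3) → EuclideanSpace ℝ (Fin 3))
      (W : ℝ → EuclideanSpace ℝ (Fin 3) → EuclideanSpace ℝ (Fin 3)),
      (∀ k, IsTypeIAncientMild C (w k)) → (∀ k, P (w k)) → IsTypeIAncientMild C W →
      (∀ t < 0, ∀ x, Tendsto (fun j => w j t x) atTop (𝓝 (W t x))) →
      (∀ t < 0, ∀ x, Tendsto (fun j => fderiv ℝ (w j t) x) atTop (𝓝 (fderiv ℝ (W t) x))) → P W)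
    (hv : IsTypeIAncientMild C v) (hPv : P v) {s₀ : ℝ} (hs₀ : s₀ < 0) {y₀ : EuclideanSpace ℝ (Fin 3)}
    (hne : curl (v s₀) y₀ ≠ 0) :
    ∃ (W : ℝ → EuclideanSpace ℝ (Fin 3) → EuclideanSpace ℝ (Fin 3)) (M : ℝ),
      IsTypeIAncientMild C W ∧ P W ∧ 0 < M ∧
      (∀ t < 0, ∀ x, (-t) ^ 2 * ⟪curl (v t) x, curl (v t) x⟫_ℝ ≤ M) ∧
      (∀ t < 0, ∀ x, (-t) ^ 2 * ⟪curl (W t) x, curl (W t) x⟫_ℝ ≤ M) ∧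
      ⟪curl (W (-1)) 0, curl (W (-1)) 0⟫_ℝ = M := by
  -- the class data of `v` in the route's four-hypothesis form
  have hrate : HasTypeITimeDecay C v := hv.hasTypeITimeDecay
  have hcont : ContinuousOn (uncurry v) (Iio (0 : ℝ) ×ˢ univ) := hv.continuousOn_uncurry
  have hmild : ∀ s t : ℝ, s < t → t < 0 → ∀ x,
      v t x = UnboundedOperators.heatExtension (v s) (t - s) x - oseenDuhamel 1 s v v t x :=
    fun s t hst ht x => hv.mild_eq_heatExtension hst ht x
  -- the scale-invariant enstrophy and its supremum
  set Q : ℝ → EuclideanSpace ℝ (Fin 3) → ℝ := fun t x => (-t) ^ 2 * ⟪curl (v t) x, curl (v t) x⟫_ℝ with hQdef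
  obtain ⟨C₂, hC₂⟩ := exists_curl_rate_of_class hrate hcont hmild
  have hQle : ∀ t < 0, ∀ x, Q t x ≤ C₂ ^ 2 := by
    intro t ht x
    have h1 : ‖curl (v t) x‖ ≤ C₂ / (-t) := hC₂ t ht x
    have h2 : (-t) * ‖curl (v t) x‖ ≤ C₂ := by
      rw [le_div_iff₀ (neg_pos.2 ht)] at h1; linarith
    have h3 : 0 ≤ (-t) * ‖curl (v t) x‖ := mul_nonneg (neg_pos.2 ht).le (norm_nonneg _)
    simp only [hQdef, real_inner_self_eq_norm_sq]
    nlinarith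
  set S : Set ℝ := {m | ∃ t < 0, ∃ x, m = Q t x} with hSdef
  have hSbdd : BddAbove S := ⟨C₂ ^ 2, by rintro m ⟨t, ht, x, rfl⟩; exact hQle t ht x⟩
  have hS0 : Q s₀ y₀ ∈ S := ⟨s₀, hs₀, y₀, rfl⟩
  set M : ℝ := sSup S with hMdef
  have hQM : ∀ t < 0, ∀ x, Q t x ≤ M := fun t ht x => le_csSup hSbdd ⟨t, ht, x, rfl⟩
  have hQ0pos : 0 < Q s₀ y₀ := by
    simp only [hQdef, real_inner_self_eq_norm_sq]
    exact mul_pos (pow_pos (neg_pos.2 hs₀) 2) (pow_pos (norm_pos_iff.2 hne) 2)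
  have hMpos : 0 < M := hQ0pos.trans_le (hQM s₀ hs₀ y₀)
  -- near-maximal points
  have hpts : ∀ k : ℕ, ∃ t < 0, ∃ x : EuclideanSpace ℝ (Fin 3), M - 1 / ((k : ℝ) + 1) < Q t x := by
    intro k
    have hlt : M - 1 / ((k : ℝ) + 1) < sSup S := by
      have : (0 : ℝ) < 1 / ((k : ℝ) + 1) := by positivity
      rw [hMdef]; linarith
    obtain ⟨m, ⟨t, ht, x, rfl⟩, hm⟩ := exists_lt_of_lt_csSup ⟨_, hS0⟩ hlt
    exact ⟨t, ht, x, hm⟩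
  choose tk htk xk hxk using hpts
  -- renormalisation to the hot spot `(−1, 0)`
  set vk : ℕ → ℝ → EuclideanSpace ℝ (Fin 3) → EuclideanSpace ℝ (Fin 3) := fun k =>
    nsRescale (Real.sqrt (-tk k)) (fun t x => v t (xk k + x)) with hvk_def
  have hck : ∀ k, 0 < Real.sqrt (-tk k) := fun k => Real.sqrt_pos.2 (neg_pos.2 (htk k))
  have hck2 : ∀ k, Real.sqrt (-tk k) ^ 2 = -tk k := fun k => Real.sq_sqrt (neg_pos.2 (htk k)).le
  have hvk : ∀ k, IsTypeIAncientMild C (vk k) := fun k =>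
    isTypeIAncientMild_nsRescale (isTypeIAncientMild_translate hv (xk k)) (hck k)
  have hvkP : ∀ k, P (vk k) := fun k => hPsc _ _ (hck k) (hPtr _ (xk k) hPv)
  -- the scale-invariant enstrophy of `vk k` is that of `v` at the moved point
  have hQvk : ∀ k, ∀ t < 0, ∀ x, (-t) ^ 2 * ⟪curl (vk k t) x, curl (vk k t) x⟫_ℝ =
      Q (Real.sqrt (-tk k) ^ 2 * t) (xk k + Real.sqrt (-tk k) • x) := by
    intro k t ht x
    simp only [hvk_def, hQdef]
    exact critEnstrophy_nsRescale_translate _ _ _ _ _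
  have hQvk_le : ∀ k, ∀ t < 0, ∀ x, (-t) ^ 2 * ⟪curl (vk k t) x, curl (vk k t) x⟫_ℝ ≤ M := by
    intro k t ht x
    rw [hQvk k t ht x]
    refine hQM _ ?_ _
    rw [hck2]
    exact mul_neg_of_pos_of_neg (neg_pos.2 (htk k)) ht
  have hQvk_one : ∀ k, ⟪curl (vk k (-1)) 0, curl (vk k (-1)) 0⟫_ℝ = Q (tk k) (xk k) := by
    intro k
    have h := hQvk k (-1) (by norm_num) 0
    rw [hck2, smul_zero, add_zero] at h
    have e : -tk k * (-1 : ℝ) = tk k := by ring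
    rw [e] at h
    simpa using h
  -- extraction of a limit
  obtain ⟨φ, hφ, W, hW, hpt, hgrad, -, -⟩ := exists_tendsto_of_isTypeIAncientMild_seq C hvk
  have hPW : P W := hPlim (fun j => vk (φ j)) W (fun j => hvk (φ j)) (fun j => hvkP (φ j)) hW hpt hgrad
  -- convergence of the enstrophy densities
  have hconv : ∀ t < 0, ∀ x, Tendsto (fun j => ⟪curl (vk (φ j) t) x, curl (vk (φ j) t) x⟫_ℝ) atTop
      (𝓝 ⟪curl (W t) x, curl (W t) x⟫_ℝ) := by
    intro t ht x
    have hc := tendsto_curl_of_tendsto_fderiv (hgrad t ht x)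
    exact hc.inner hc
  refine ⟨W, M, hW, hPW, hMpos, hQM, fun t ht x => ?_, ?_⟩
  · have h := (hconv t ht x).const_mul ((-t) ^ 2)
    exact le_of_tendsto' h fun j => hQvk_le (φ j) t ht x
  · -- at the hot spot the values `Q (t_{φ j}) (x_{φ j}) ∈ (M − 1/(φ j + 1), M]` converge to `M`
    have h1 := hconv (-1) (by norm_num) 0
    have hεj : Tendsto (fun j : ℕ => M - 1 / ((φ j : ℝ) + 1)) atTop (𝓝 M) := by
      have h0 : Tendsto (fun j : ℕ => 1 / ((φ j : ℝ) + 1)) atTop (𝓝 0) := by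
        have ha : Tendsto (fun j : ℕ => (φ j : ℝ) + 1) atTop atTop := by
          refine tendsto_atTop_add_const_right _ 1 ?_
          exact tendsto_natCast_atTop_atTop.comp hφ.tendsto_atTop
        refine (tendsto_inv_atTop_zero.comp ha).congr fun j => ?_
        simp [one_div, Function.comp]
      simpa using (tendsto_const_nhds (x := M)).sub h0
    have h2 : Tendsto (fun j => ⟪curl (vk (φ j) (-1)) 0, curl (vk (φ j) (-1)) 0⟫_ℝ) atTop (𝓝 M) := by
      refine tendsto_of_tendsto_of_tendsto_of_le_of_le hεj tendsto_const_nhds (fun j => ?_) (fun j => ?_)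
      · rw [hQvk_one]; exact (hxk (φ j)).le
      · rw [hQvk_one]; exact hQM _ (htk (φ j)) _
    exact tendsto_nhds_unique h1 h2

end Summit.NavierStokesRegularity.NavierStokesRegularity.Theorems.PoloidalWindowDoorPoloidalWindowRigidityEnstrophyHotSpot

end
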